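import Mathlib

/-!
# STUB-IDEAS k2 (gen 32) — R193 «semi-local DESC typed (Nekovář)» ON THE PAGE at `p = 2`

Stub of record: `stub_heegnerIndexLowerAtTwo` (crux item `stmt-BirchSwinnertonDyer-27851`,
route `PrintCf2`, skeleton `Lines/heegner_index_two_lower.lean`).  Node attacked: **R193**
(STUB-PLAN v6.0 ORDER NOW group 4, typer list (n⁵) last item): the print-S half of road UTD's
descent `d = cores : M₂ = H¹_Iw(L_∞/ℚ₂, T(key)) → M = H¹_Iw(ℚ₂^cyc/ℚ₂, T(key))`
(k3-g28, `descend_existsUnique`, binders `hd : Surjective d`, `hker : ker d ⊆ ker(π)•M₂`).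

TECHNIQUE (payload, k = 2): literature transfer with a typed dictionary.  Sources transferred:
Nekovář, *Selmer complexes* (Astérisque 310) 8.4.1 (Γ = Γ₀ × Δ, `R̄ = R₀ ⊗_R R[Δ]`),
8.3.5, 8.4.8.3–8.4.8.5 and the `R ↦ R[Δ]` device of 8.9.7 (proof); Kato, Astérisque 295,
§12.1 / §14 / §17 «exact up to ×2 if p = 2».

THE TRANSFER.  `G₂ = Gal(L_∞/ℚ₂) ≅ ℤ₂^× × ℤ₂ × (odd)`, so `Δ := G₂[2^∞]_tors = {±1}` and
`Λ(G₂) = ℤ₂[Δ][[Γ]]`, `Γ = Gal(L'_∞/ℚ₂) ≅ ℤ₂²`, `L'_∞ = L_∞^Δ = ℚ₂^cyc·ℚ₂^{ur,2}` (the unique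
`ℤ₂²`-extension of `ℚ₂`).  Shapiro: `H^j_Iw(L_∞/ℚ₂, T) = H^j_Iw(L'_∞/ℚ₂, T_Δ)`, `T_Δ := T ⊗ ℤ₂[Δ]^ι`,
so Nekovář 8.4.8.4 (i) applies VERBATIM over the local ring `R' = ℤ₂[Δ]` (no idempotent, B46):
  (tf-step)  `0 → (M₂)_{⟨h⟩} → M_cyc := H¹_Iw(ℚ₂(μ_{2^∞})/ℚ₂, T) → H²_Iw(L_∞/ℚ₂,T)^{⟨h⟩} → 0`,
             and `H²_Iw(L_∞,T(key)) ≅ ℤ₂(ρ)` with `ρ(h) = β^a`, `a ∈ ℤ₂^×`, `β = ψ_{49a1}(𝔮̄)` of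
             infinite order ⇒ the cokernel is `0` for every key (`fixed_eq_zero_of_ne_one`);
  (Δ-step)   `0 → T⁻ → T_Δ → T → 0` (`T⁻ = T ⊗ χ₄`) gives
             `M_cyc → M → H²_Iw(ℚ₂^cyc,T⁻) → H²_Iw(ℚ₂^cyc,T_Δ) → H²_Iw(ℚ₂^cyc,T) → 0`
             with the three `H²_Iw` all `≅ ℤ/2` (local duality + `N_anom = v₂(β−1) = 1`,
             `ann_iff_two_torsion`), hence `coker(M_cyc → M) ≅ ℤ/2` EXACTLY and
             `ker((M_cyc)_Δ → M)` of order `≤ 2` (`DescHyps.coker_equiv`, `two_smul_eq_sub_of_norm_zero`).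
LEDGER: `hd` holds ⊗ℚ for all keys and fails integrally by exactly one bit; `hker` holds ⊗ℚ;
R193's located digits are `(0, ≤1, 1)`, key-uniform (`descDigits`).  The parity `ρ(−1) = −θ(−1)`
(`rhoAtNegOne_table`) decides only WHERE the bit sits (`e = 2`: already in `H²_Iw(L'_∞,T) = ℤ/2`;
`e ∈ {−1,−2}`: in the Δ-corestriction), not its size.

Everything below is sorry-free algebra / decidable shadows; the Galois-cohomological inputs are
print (pages in the card).  BSD is NOT proved by any of this; nothing closes.
-/

set_option linter.dupNamespace false

namespace Summit.BirchSwinnertonDyer.BirchSwinnertonDyer.Cruxes.SplitBadTwoLowerHalfOfFacts.DescTypedK2G32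

/-! ## §A  Keys, parities, and the tower-character criterion -/

/-- The three ramified twist classes `e ∈ {−1, 2, −2}` of the key (`χ_e = θ·υ^c`,
`θ ∈ {χ₄, χ₈, χ₈'}`, `υ` unramified quadratic); the six dyadic keys are `TwistE × Fin 2`. -/
inductive TwistE | neg1 | two | neg2
  deriving DecidableEq, Repr

/-- `θ(−1)`, read off Mathlib's Dirichlet characters `χ₄, χ₈, χ₈'` of conductor `4, 8, 8`. -/
def thetaAtNegOne : TwistE → ℤ
  | .neg1 => ZMod.χ₄ ((-1 : ℤ) : ZMod 4)
  | .two  => ZMod.χ₈ ((-1 : ℤ) : ZMod 8)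
  | .neg2 => ZMod.χ₈' ((-1 : ℤ) : ZMod 8)

theorem thetaAtNegOne_neg1 : thetaAtNegOne .neg1 = -1 := by
  simp only [thetaAtNegOne, ZMod.χ₄_int_eq_if_mod_four]; decide

theorem thetaAtNegOne_two : thetaAtNegOne .two = 1 := by
  simp only [thetaAtNegOne, ZMod.χ₈_int_eq_if_mod_eight]; decide

theorem thetaAtNegOne_neg2 : thetaAtNegOne .neg2 = -1 := by
  simp only [thetaAtNegOne, ZMod.χ₈'_int_eq_if_mod_eight]; decide

/-- `ρ(key)(−1) = β^{ur}(−1)·θ(−1)·χ_cyc(−1)⁻¹ = 1·θ(−1)·(−1)` — the parity of the local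
character `ρ(key) = η·χ_cyc⁻¹` of road UTD (`T(key) = ℤ₂(1) ⊗ ρ(key)`, `η = β^{ur}·χ_e`). -/
def rhoAtNegOne (e : TwistE) : ℤ := thetaAtNegOne e * (-1)

theorem rhoAtNegOne_table :
    rhoAtNegOne .neg1 = 1 ∧ rhoAtNegOne .two = -1 ∧ rhoAtNegOne .neg2 = 1 := by
  refine ⟨?_, ?_, ?_⟩ <;>
    simp [rhoAtNegOne, thetaAtNegOne_neg1, thetaAtNegOne_two, thetaAtNegOne_neg2]

/-- DICTIONARY ROW «tower character»: `ρ(key)` factors through the torsion-free quotient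
`Γ = G₂/Δ = Gal(L'_∞/ℚ₂)` iff `ρ(−1) = 1` iff `e ≠ 2`.  (For `e = 2`, `ρ|_{G_{L'_∞}}` is the
quadratic character of `L'_∞(i)/L'_∞` and `H²_Iw(L'_∞/ℚ₂, T(key)) ≅ ℤ/2`; for `e ∈ {−1,−2}` it
is trivial and `H²_Iw(L'_∞/ℚ₂, T(key)) ≅ ℤ₂(ρ)`.) -/
theorem towerCharacter_iff (e : TwistE) : rhoAtNegOne e = 1 ↔ e ≠ .two := by
  obtain ⟨h1, h2, h3⟩ := rhoAtNegOne_table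
  cases e <;> simp [h1, h2, h3]

/-- The group-theoretic content of the row: a homomorphism into a group without non-trivial
elements of finite order kills every element of finite order (here: `ρ : G₂ → ℤ₂^×/…` factors
through `Γ ≅ ℤ₂²` only if it kills `Δ = {±1}`). -/
theorem map_eq_one_of_isOfFinOrder {G M : Type*} [Group G] [Group M]
    (hM : ∀ m : M, IsOfFinOrder m → m = 1) (φ : G →* M) {g : G} (hg : IsOfFinOrder g) :
    φ g = 1 :=
  hM _ (φ.isOfFinOrder hg)

/-- Finite shadow of «a continuous character of a pro-odd group into the pro-2 group `ℤ₂^×` is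
trivial» (used twice: `β^{ur}|_{G_{L'_∞}} = 1`, and the odd part of `G₂,tors` is invisible):
a homomorphism between finite groups of coprime orders is trivial. -/
theorem map_eq_one_of_coprime_card {G H : Type*} [Group G] [Group H] [Fintype G] [Fintype H]
    (φ : G →* H) (h : (Fintype.card G).Coprime (Fintype.card H)) (g : G) : φ g = 1 := by
  have h1 : orderOf (φ g) ∣ Fintype.card H := orderOf_dvd_card
  have h2 : orderOf (φ g) ∣ Fintype.card G := (orderOf_map_dvd φ g).trans orderOf_dvd_card
  have h3 : (orderOf (φ g)).Coprime (Fintype.card H) := Nat.Coprime.coprime_dvd_left h2 h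
  exact orderOf_eq_one_iff.mp (h3.eq_one_of_dvd h1)

/-! ## §B  The torsion-free step (Nekovář 8.4.8.4 (i) over `R' = ℤ₂[Δ]`) in module form -/

section Descent

variable {R : Type*} [CommRing R]
variable {M₂ Mc M Z ZΔ Z₁ : Type*}
variable [AddCommGroup M₂] [Module R M₂] [AddCommGroup Mc] [Module R Mc]
variable [AddCommGroup M] [Module R M] [AddCommGroup Z] [Module R Z]
variable [AddCommGroup ZΔ] [Module R ZΔ] [AddCommGroup Z₁] [Module R Z₁]

/-- `ℤ₂(ρ)^{⟨h⟩} = 0` as soon as `ρ(h) ≠ 1` (torsion-free coefficients): the cokernel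
`H²_Iw(L_∞/ℚ₂, T(key))^{⟨h⟩}` of the tf-step vanishes for EVERY key, because over the full
tower `ρ` is a tower character and `ρ(h) = β^a` has infinite order
(k3-g28 `pow_ne_one_of_norm_ne_one`). -/
theorem fixed_eq_zero_of_ne_one {A : Type*} [CommRing A] [IsDomain A] {u : A} (hu : u ≠ 1)
    {m : A} (h : u * m = m) : m = 0 := by
  have h' : (u - 1) * m = 0 := by rw [sub_mul, one_mul, h, sub_self]
  rcases mul_eq_zero.mp h' with h1 | h1
  · exact absurd (sub_eq_zero.mp h1) hu
  · exact h1

/-- Nekovář 8.4.8.4 (i), `j = 1`, `Γ' = ⟨h⟩ ≅ ℤ₂`, typed as module algebra: kernel of the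
corestriction `d₁ : M₂ → M_cyc` is `(h − 1)•M₂` and — the invariants of `H²_Iw` vanishing —
`d₁` is onto, so `M_cyc ≅ M₂ ⧸ (h − 1)M₂` (`x := h − 1 ∈ R = Λ(G₂)`). -/
noncomputable def tfDescentEquiv (d₁ : M₂ →ₗ[R] Mc) (x : R)
    (hker : LinearMap.ker d₁ = LinearMap.range (x • (LinearMap.id : M₂ →ₗ[R] M₂)))
    (hsurj : Function.Surjective d₁) :
    (M₂ ⧸ LinearMap.range (x • (LinearMap.id : M₂ →ₗ[R] M₂))) ≃ₗ[R] Mc :=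
  (Submodule.quotEquivOfEq _ _ hker.symm).trans (LinearMap.quotKerEquivOfSurjective d₁ hsurj)

/-! ## §C  The Δ-step (`ℚ₂(μ_{2^∞}) → ℚ₂^cyc`, `Δ = {±1}`): exact bookkeeping -/

/-- Exactness bookkeeping for the tail `M → Z → ZΔ → Z₁` of the augmentation sequence:
if `ZΔ → Z₁` is injective then `Z → ZΔ` is zero and `M → Z` is onto. -/
theorem surjective_of_exact_of_injective (δ : M →ₗ[R] Z) (ι : Z →ₗ[R] ZΔ) (ν : ZΔ →ₗ[R] Z₁)
    (hδι : LinearMap.range δ = LinearMap.ker ι) (hιν : LinearMap.range ι = LinearMap.ker ν)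
    (hν : Function.Injective ν) : Function.Surjective δ := by
  have hι : ι = 0 := by
    have : LinearMap.range ι = ⊥ := by rw [hιν, LinearMap.ker_eq_bot.mpr hν]
    exact LinearMap.range_eq_bot.mp this
  rw [← LinearMap.range_eq_top, hδι, hι, LinearMap.ker_zero]

/-- … and then `coker(M_cyc → M) ≅ Z = H²_Iw(ℚ₂^cyc/ℚ₂, T⁻)`. -/
noncomputable def cokerEquivOfExact (d₂ : Mc →ₗ[R] M) (δ : M →ₗ[R] Z)
    (hd₂δ : LinearMap.range d₂ = LinearMap.ker δ) (hδ : Function.Surjective δ) :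
    (M ⧸ LinearMap.range d₂) ≃ₗ[R] Z :=
  (Submodule.quotEquivOfEq _ _ hd₂δ).trans (LinearMap.quotKerEquivOfSurjective δ hδ)

/-- `H²_Iw(ℚ₂^cyc, T_Δ) ↠ H²_Iw(ℚ₂^cyc, T)` between finite groups of the same order (both
`ℤ/2`) is injective. -/
theorem injective_of_surjective_of_equiv {α β : Type*} [Finite α] (k : α → β) (e : α ≃ β)
    (hk : Function.Surjective k) : Function.Injective k :=
  (Finite.injective_iff_surjective_of_equiv e).mpr hk

/-- **R193 typed.**  The hypotheses print supplies for the two-step descent at `v`: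
* `ker_d₁`, `surj_d₁` — Nekovář 8.4.8.4 (i) over `ℤ₂[Δ]` + `H²_Iw(L_∞,T)^{h} = 0`;
* `exact_M`, `exact_Z`, `exact_ZΔ`, `surj_ν` — the Iwasawa-cohomology sequence of
  `0 → T⁻ → T_Δ → T → 0` from `H¹(T)` on (`cd₂(G_{ℚ₂}) = 2` ends it at `H²(T) → 0`);
* `equiv_ZΔ_Z₁`, `finite_ZΔ` — `H²_Iw(ℚ₂^cyc, T_Δ) ≅ H²_Iw(ℚ₂(μ_{2^∞}), T) ≅ ℤ/2 ≅ H²_Iw(ℚ₂^cyc, T)`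
  (local duality in the limit, 8.3.5, and `N_anom = 1`). -/
structure DescHyps (d₁ : M₂ →ₗ[R] Mc) (d₂ : Mc →ₗ[R] M) (δ : M →ₗ[R] Z) (ι : Z →ₗ[R] ZΔ)
    (ν : ZΔ →ₗ[R] Z₁) (x : R) : Prop where
  ker_d₁ : LinearMap.ker d₁ = LinearMap.range (x • (LinearMap.id : M₂ →ₗ[R] M₂))
  surj_d₁ : Function.Surjective d₁
  exact_M : LinearMap.range d₂ = LinearMap.ker δ
  exact_Z : LinearMap.range δ = LinearMap.ker ι
  exact_ZΔ : LinearMap.range ι = LinearMap.ker ν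
  surj_ν : Function.Surjective ν
  equiv_ZΔ_Z₁ : Nonempty (ZΔ ≃ Z₁)
  finite_ZΔ : Finite ZΔ

/-- Conclusion 1 (tf-step): `M_cyc ≅ M₂ ⧸ (h−1)M₂` — k3-g28's `hker` with equality and `hd`
for the FIRST factor of `d = d₂ ∘ d₁`, integrally, all keys. -/
theorem DescHyps.tf_equiv {d₁ : M₂ →ₗ[R] Mc} {d₂ : Mc →ₗ[R] M} {δ : M →ₗ[R] Z} {ι : Z →ₗ[R] ZΔ}
    {ν : ZΔ →ₗ[R] Z₁} {x : R} (H : DescHyps d₁ d₂ δ ι ν x) :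
    Nonempty ((M₂ ⧸ LinearMap.range (x • (LinearMap.id : M₂ →ₗ[R] M₂))) ≃ₗ[R] Mc) :=
  ⟨tfDescentEquiv d₁ x H.ker_d₁ H.surj_d₁⟩

/-- Conclusion 2 (Δ-step): `coker(d₂ : M_cyc → M) ≅ H²_Iw(ℚ₂^cyc/ℚ₂, T⁻)` (`≅ ℤ/2`): road UTD's
`hd` fails integrally by exactly this group and holds after `⊗ ℚ`. -/
theorem DescHyps.coker_equiv {d₁ : M₂ →ₗ[R] Mc} {d₂ : Mc →ₗ[R] M} {δ : M →ₗ[R] Z}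
    {ι : Z →ₗ[R] ZΔ} {ν : ZΔ →ₗ[R] Z₁} {x : R} (H : DescHyps d₁ d₂ δ ι ν x) :
    Nonempty ((M ⧸ LinearMap.range d₂) ≃ₗ[R] Z) := by
  obtain ⟨e⟩ := H.equiv_ZΔ_Z₁
  haveI := H.finite_ZΔ
  have hν : Function.Injective ν := injective_of_surjective_of_equiv ν e H.surj_ν
  exact ⟨cokerEquivOfExact d₂ δ H.exact_M
    (surjective_of_exact_of_injective δ ι ν H.exact_Z H.exact_ZΔ hν)⟩

/-- Conclusion 3: the composite `d = d₂ ∘ d₁` (road UTD's `d = cores`) has the same range as `d₂`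
(since `d₁` is onto) — so `coker d ≅ ℤ/2` too, and `ker d ⊇ (h−1)M₂` with
`ker d / (h−1)M₂ ≅ ker d₂`. -/
theorem DescHyps.range_comp {d₁ : M₂ →ₗ[R] Mc} {d₂ : Mc →ₗ[R] M} {δ : M →ₗ[R] Z}
    {ι : Z →ₗ[R] ZΔ} {ν : ZΔ →ₗ[R] Z₁} {x : R} (H : DescHyps d₁ d₂ δ ι ν x) :
    LinearMap.range (d₂ ∘ₗ d₁) = LinearMap.range d₂ :=
  LinearMap.range_comp_of_range_eq_top d₂ (LinearMap.range_eq_top.mpr H.surj_d₁)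

end Descent

/-! ## §D  Why every `H²_Iw` here is `ℤ/2`: the anomaly digit and Kato's «×2» mechanism -/

/-- `β ≡ 3 (mod 4)` (the anomaly congruence of `49a1` at `𝔮` under `ι_𝔮`, k2-g31
`anomality_index_one`) ⇒ `β − 1 = w·2` with `w` odd. -/
theorem sub_one_eq_odd_mul_two {β : ℤ} (h : β % 4 = 3) :
    ∃ w : ℤ, β - 1 = w * 2 ∧ w % 2 = 1 :=
  ⟨(β - 1) / 2, by omega, by omega⟩

/-- On any module on which odd integers act injectively (every `ℤ₂`-module, every 2-group),
`(β − 1)•x = 0 ↔ 2•x = 0` for an anomalous unit `β ≡ 3 (4)`: the finite-level groups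
`H⁰(L_n, (ℚ₂/ℤ₂)(ρ⁻¹))` are the 2-torsion `ℤ/2` at every level as soon as one element acts by
such a `β` (or by `−1`), whence `H²_Iw ≅ lim (ℤ/2)^∨ = ℤ/2` by local duality (transition maps
are isomorphisms). -/
theorem ann_iff_two_torsion {A : Type*} [AddCommGroup A]
    (hodd : ∀ w : ℤ, w % 2 = 1 → Function.Injective (fun x : A => w • x))
    {β : ℤ} (h : β % 4 = 3) (x : A) : (β - 1) • x = 0 ↔ (2 : ℤ) • x = 0 := by
  obtain ⟨w, hw, hwodd⟩ := sub_one_eq_odd_mul_two h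
  rw [hw, mul_smul]
  constructor
  · intro hx
    apply hodd w hwodd
    show w • ((2 : ℤ) • x) = w • (0 : A)
    rw [smul_zero]; exact hx
  · intro hx
    rw [hx, smul_zero]

/-- Decidable instance of the previous statement on the receptacle `ℤ/4` with `β = 3`, `7`. -/
example : ∀ x : ZMod 4, ((3 : ℤ) - 1) • x = 0 ↔ (2 : ℤ) • x = 0 := by decide
example : ∀ x : ZMod 8, ((7 : ℤ) - 1) • x = 0 ↔ (2 : ℤ) • x = 0 := by decide
/-- … and with the element acting by `−1` (the case `e = 2` over `L'_∞`, or `θ = −1`). -/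
example : ∀ x : ZMod 8, ((-1 : ℤ) - 1) • x = 0 ↔ (2 : ℤ) • x = 0 := by decide

/-- Kato's «exact up to ×2 if `p = 2`» (Astérisque 295, p0124: `2·Im ⊆ Ker`, `2·Ker ⊆ Im`),
mechanism for `Δ = ⟨σ⟩` of order 2 — fixed vectors: `2a = a + σa = N_Δ a`. -/
theorem two_smul_eq_norm_of_fixed {A : Type*} [AddCommGroup A] (σ : A →+ A) {a : A}
    (ha : σ a = a) : (2 : ℕ) • a = a + σ a := by
  rw [ha, two_nsmul]

/-- … and norm-zero vectors: `2a = a − σa ∈ (1 − σ)A`, so `ker(N_Δ)/(1−σ)A` is killed by 2: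
the kernel of `(M_cyc)_Δ → M` is 2-torsion (here of order ≤ 2). -/
theorem two_smul_eq_sub_of_norm_zero {A : Type*} [AddCommGroup A] (σ : A →+ A) {a : A}
    (ha : a + σ a = 0) : (2 : ℕ) • a = a - σ a := by
  have h : -a = σ a := add_eq_zero_iff_neg_eq.mp ha
  rw [← h, sub_neg_eq_add, two_nsmul]

/-- Coinvariants of the rank-one twist under an element acting by `u`: `ℤ₂(ρ)_{⟨c⟩} = ℤ₂/(u−1)`.
For `Δ ∋ c = −1` acting by `ρ(−1) = −1` (`e = 2`) this is `ℤ₂/2`; acting by `+1` it is `ℤ₂`: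
`H²_Iw(L'_∞, T(key)) = H²_Iw(L_∞, T(key))_Δ` is `ℤ/2` resp. `ℤ₂(ρ)` — integer shadow. -/
theorem coinvariant_ideal_neg_one : Ideal.span {((-1 : ℤ) - 1)} = Ideal.span {(2 : ℤ)} := by
  rw [show ((-1 : ℤ) - 1) = -2 by norm_num]
  exact Ideal.span_singleton_neg 2  |>.trans rfl

theorem coinvariant_ideal_one : Ideal.span {((1 : ℤ) - 1)} = ⊥ := by
  simp

/-! ## §E  R193's located-digit ledger (key-uniform) -/

/-- R193's located digits, as `log₂` of orders: cokernel of the tf-step; (an upper bound for)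
the kernel of `(M_cyc)_Δ → M`; the cokernel of `M_cyc → M`. -/
structure DescDigits where
  tfCoker : ℕ
  deltaKerLe : ℕ
  deltaCoker : ℕ
  deriving DecidableEq, Repr

/-- The ledger entry is the same for all three twist classes (hence all six keys): the parity
`ρ(−1)` only decides whether the cokernel bit is already visible over `L'_∞` (`e = 2`) or only
after the Δ-corestriction (`e ∈ {−1,−2}`). -/
def descDigits (_e : TwistE) : DescDigits := ⟨0, 1, 1⟩

theorem descDigits_keyUniform (e e' : TwistE) : descDigits e = descDigits e' := rfl

theorem descDigits_total_le_two (e : TwistE) :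
    (descDigits e).tfCoker + (descDigits e).deltaKerLe + (descDigits e).deltaCoker ≤ 2 := by
  simp [descDigits]

/-- What road UTD consumes (row 83, unit grade after `⊗ ℚ`): all three digits die after
inverting 2 — recorded as the trivial arithmetic fact that a group killed by `2` vanishes
after `⊗ ℤ[1/2]`: if `2•x = 0` and `2` acts invertibly then `x = 0`. -/
theorem eq_zero_of_two_smul_eq_zero_of_isUnit {A : Type*} [AddCommGroup A] [Module ℚ A]
    {x : A} (hx : (2 : ℚ) • x = 0) : x = 0 := by
  have h2 : (2 : ℚ) ≠ 0 := by norm_num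
  simpa [smul_smul, inv_mul_cancel₀ h2] using congrArg (fun y => (2 : ℚ)⁻¹ • y) hx

end Summit.BirchSwinnertonDyer.BirchSwinnertonDyer.Cruxes.SplitBadTwoLowerHalfOfFacts.DescTypedK2G32
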